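import Summits.Ventures.HodgeRepro2.T5CompactGroupHaar
import Mathlib.Topology.Instances.ZMod
import Mathlib.MeasureTheory.Measure.Count

/-!
# T5QuotientToy — a non-vacuity witness for rows 41–46

Cell pub-hodge-repro2, seat p5, Tier 5.  The hypothesis package of rows 42 / 46 — a compact
Hausdorff locally compact Borel group `K` with a measurable, measure-preserving action on an
s-finite `(X, μ)` — is instantiated simultaneously on the smallest non-trivial example: the group
`K₂ = Multiplicative (ZMod 2)` (discrete, hence compact, Hausdorff, locally compact; the full
σ-algebra is its Borel σ-algebra) acting on itself by multiplication with the counting measure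
(left-invariant, hence `SMulInvariantMeasure`).  The objects of rows 41–46 then exist
(`toyInvariantsEquiv`), all their hypotheses are discharged by instances (`toy_hypotheses`),
and the orbit space is a point (`subsingleton_orbitRel_quotient`), so that `invariants count` is
the one-dimensional space of constant functions — the expected answer.  A witness in the sense of
README §10.5(ii)(c)/(d), nothing more.  Mathlib only besides rows 41–46.  Axioms: propext,
Classical.choice, Quot.sound.  README §8(d): uses an L-value-free non-vanishing device: NO.
-/

namespace Summit.Ventures.HodgeRepro2.T5QuotientToy

open MeasureTheory
open Summit.Ventures.HodgeRepro2.T5QuotientPullback Summit.Ventures.HodgeRepro2.T5QuotientDescent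
  Summit.Ventures.HodgeRepro2.T5CompactGroupHaar

/-- The toy group: `ℤ/2` written multiplicatively (discrete topology from `ZMod 2`). -/
abbrev K₂ := Multiplicative (ZMod 2)

/-- The full σ-algebra on the toy group. -/
instance instMeasurableSpaceK₂ : MeasurableSpace K₂ := ⊤

/-- Every subset of the toy group is measurable. -/
instance instDiscreteMeasurableSpaceK₂ : DiscreteMeasurableSpace K₂ :=
  ⟨fun _ => MeasurableSpace.measurableSet_top⟩

/-- Every subset of `K₂ × K₂` is measurable (a finite set in a space with measurable
singletons). -/
instance instDiscreteMeasurableSpaceProdK₂ : DiscreteMeasurableSpace (K₂ × K₂) :=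
  ⟨fun s => (Set.toFinite s).measurableSet⟩

/-- The toy group acts measurably on itself (everything is measurable). -/
instance instMeasurableSMul₂K₂ : MeasurableSMul₂ K₂ K₂ := ⟨Measurable.of_discrete⟩

/-- **The witness**: rows 41–46 instantiated on `K₂` acting on itself with the counting measure. -/
noncomputable def toyInvariantsEquiv :
    Lp ℂ 2 (quotMeasure (K := K₂) (Measure.count : Measure K₂)) ≃ₗᵢ[ℂ]
      invariants (K := K₂) (Measure.count : Measure K₂) :=
  invariantsEquiv_compact (Measure.count : Measure K₂)

/-- Every hypothesis of rows 42 / 46 holds on the toy by instance resolution. -/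
theorem toy_hypotheses :
    CompactSpace K₂ ∧ T2Space K₂ ∧ LocallyCompactSpace K₂ ∧ BorelSpace K₂ ∧ MeasurableMul K₂ ∧
      IsProbabilityMeasure (T5SchurMathlib.haarProb K₂) ∧
      (T5SchurMathlib.haarProb K₂).IsMulRightInvariant ∧
      SFinite (Measure.count : Measure K₂) ∧ SMulInvariantMeasure K₂ K₂ (Measure.count : Measure K₂) :=
  ⟨inferInstance, inferInstance, inferInstance, inferInstance, inferInstance, inferInstance,
    inferInstance, inferInstance, inferInstance⟩

/-- The orbit space of a group acting on itself is a point. -/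
theorem subsingleton_orbitRel_quotient : Subsingleton (MulAction.orbitRel.Quotient K₂ K₂) :=
  ⟨fun q q' => by
    refine Quotient.inductionOn' q fun a => Quotient.inductionOn' q' fun b => ?_
    exact Quotient.sound' (MulAction.orbitRel_apply.2 (MulAction.mem_orbit_iff.2
      ⟨a * b⁻¹, by rw [smul_eq_mul, inv_mul_cancel_right]⟩))⟩

end Summit.Ventures.HodgeRepro2.T5QuotientToy
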